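import Literature.Analysis.UnboundedOperators.LinearizedBoltzmannPositivityProofs
import HarnessLib

/-!
# Proofs for `LinearizedBoltzmann`: the variational family is bounded by `‖A‖²_M / λ`

Companion of `Literature/Analysis/UnboundedOperators/LinearizedBoltzmann.lean` (prelude C8) and
of `LinearizedBoltzmannPositivityProofs.lean`. The prelude vendors as named facts (D-0014)

* `maxwellianInner_linearizedCollisionOp_comm` (S) — symmetry `⟪h, L g⟫_M = ⟪L h, g⟫_M` on
  functions of temperate growth (CIP 1994 §7.1 (1.9));
* `le_neg_maxwellianInner_hardSphereLinearizedOp_of_orthogonal` (Z) — the spectral gap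
  `λ ‖g‖²_M ≤ -⟪g, L g⟫_M` for `g ⊥_M` collision invariants (Baranger–Mouhot 2005, Thm 1.1);
* `bddAbove_range_dirichlet_of_orthogonal` (Y) — for `A ⊥_M` collision invariants the family
  `g ↦ 2⟪A, g⟫_M + ⟪g, L g⟫_M` (`g` of temperate growth) is bounded above;
* `dirichletFormInv_pos_of_orthogonal_of_ne_zero` — `⟪A, (-L)⁻¹ A⟫_M > 0` for `A ≠ 0`.

This file proves **Y from S and Z** (`bddAbove_range_dirichlet_of_orthogonal_of_comm_of_gap`,
with the explicit bound `‖A‖²_M / λ`), hence, with the positivity file, the positivity fact from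
S and Z (`dirichletFormInv_pos_of_orthogonal_of_ne_zero_of_comm_of_gap`). The argument
(CIP 1994 §7.2, Thm 7.2.1: `L` self-adjoint, non-positive, null space = collision invariants;
complete the square) is arranged so that the Bochner junk value never interferes:

1. `exists_mem_collisionInvariants_forall_maxwellianInner_sub_eq_zero`: every `g` of temperate
   growth splits as `g = g₁ + p`, `p` a collision invariant, `g₁ ⊥_M` collision invariants — the
   `M`-orthogonal projection onto the finite-dimensional space of collision invariants
   (`finiteDimensional_collisionInvariants`), on which `⟪·, ·⟫_M` is positive definite
   (`maxwellianInner_self_pos`); obtained through `LinearMap.BilinForm.toDual`.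
2. `linearizedCollisionOp_add_of_isCollisionInvariant`: `L (g₁ + p) = L g₁` *exactly* (the
   integrands agree pointwise), so no linearity of the unbounded operator `L` is needed.
3. By S, `⟪g₁ + p, L g₁⟫_M = ⟪L (g₁ + p), g₁⟫_M = ⟪L g₁, g₁⟫_M`, so `⟪g, L g⟫_M = ⟪g₁, L g₁⟫_M`;
   and `⟪A, g⟫_M = ⟪A, g₁⟫_M + ⟪A, p⟫_M = ⟪A, g₁⟫_M` (products of temperate-growth functions are
   `M`-integrable, `integrable_stdGaussian_of_hasTemperateGrowth`).
4. By Z and `0 ≤ ‖A - λ g₁‖²_M = ‖A‖²_M - 2λ⟪A, g₁⟫_M + λ²‖g₁‖²_M`: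
   `2⟪A, g₁⟫_M + ⟪g₁, L g₁⟫_M ≤ ‖A‖²_M/λ + λ‖g₁‖²_M - λ‖g₁‖²_M = ‖A‖²_M / λ`.

The hypotheses of S for the hard-sphere kernel `((v - v_*)·ω)_+` (measurability, the bound
`|B| ≤ 2 (1 + ‖(v, v_*)‖)`, and the two invariances `hardSphereKernel_collide_neg`,
`hardSphereKernel_swap_neg` of the prelude) are checked here.

Sources: Cercignani–Illner–Pulvirenti, *The Mathematical Theory of Dilute Gases* (1994) §7.1
(1.7)–(1.11), pp. 192–193, and §7.2, Thm 7.2.1, p. 197, Thm 7.2.5, p. 201; Baranger–Mouhot,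
Rev. Mat. Iberoam. 21 (2005), Thm 1.1 (the gap, used only through the named fact Z).

Mathlib anchors: `LinearMap.BilinForm.toDual`, `LinearMap.BilinForm.apply_toDual_symm_apply`,
`LinearMap.mk₂`, `FiniteDimensional.span_of_finite`, `Submodule.finiteDimensional_of_le`,
`OrthonormalBasis.sum_repr`, `MeasureTheory.integral_add`, `MeasureTheory.integral_sub`.
-/

open MeasureTheory Metric Real ProbabilityTheory Module
open scoped InnerProductSpace ENNReal

namespace Literature.Analysis.UnboundedOperators

open Literature.MathematicalPhysics.KineticTheory (collide hardSphereKernel IsCollisionInvariant)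

noncomputable section

variable {E : Type*} [NormedAddCommGroup E] [InnerProductSpace ℝ E] [FiniteDimensional ℝ E]
  [MeasurableSpace E] [BorelSpace E]

/-! ### Algebra of the `L²(M)` pairing on functions of temperate growth -/

/-- Products of functions of temperate growth are integrable against the Maxwellian. [folklore] -/
theorem integrable_mul_stdGaussian {f g : E → ℝ} (hf : f ∈ temperateGrowth E)
    (hg : g ∈ temperateGrowth E) : Integrable (fun v => f v * g v) (stdGaussian E) :=
  integrable_stdGaussian_of_hasTemperateGrowth (Function.HasTemperateGrowth.mul hf hg)

omit [BorelSpace E] in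
/-- Symmetry of the pairing, `⟪g, h⟫_M = ⟪h, g⟫_M` (CIP 1994 §7.1 (1.8)). [folklore] -/
theorem maxwellianInner_comm (g h : E → ℝ) : maxwellianInner g h = maxwellianInner h g := by
  simp only [maxwellianInner, mul_comm]

omit [BorelSpace E] in
/-- `‖g‖²_M = ⟪g, g⟫_M ≥ 0` for every `g` (junk value included). [folklore] -/
theorem maxwellianInner_self_nonneg (g : E → ℝ) : 0 ≤ maxwellianInner g g :=
  integral_nonneg fun v => mul_self_nonneg (g v)

omit [BorelSpace E] in
/-- Additivity of the pairing in the first slot, under integrability of both products.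
[folklore] -/
theorem maxwellianInner_add_left {f g h : E → ℝ}
    (hf : Integrable (fun v => f v * h v) (stdGaussian E))
    (hg : Integrable (fun v => g v * h v) (stdGaussian E)) :
    maxwellianInner (f + g) h = maxwellianInner f h + maxwellianInner g h := by
  simp only [maxwellianInner, Pi.add_apply, add_mul]
  exact integral_add hf hg

omit [BorelSpace E] in
/-- Additivity of the pairing in the second slot, under integrability of both products.
[folklore] -/
theorem maxwellianInner_add_right {f g h : E → ℝ}
    (hg : Integrable (fun v => f v * g v) (stdGaussian E))
    (hh : Integrable (fun v => f v * h v) (stdGaussian E)) :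
    maxwellianInner f (g + h) = maxwellianInner f g + maxwellianInner f h := by
  simp only [maxwellianInner, Pi.add_apply, mul_add]
  exact integral_add hg hh

omit [BorelSpace E] in
/-- Subtractivity of the pairing in the first slot, under integrability of both products.
[folklore] -/
theorem maxwellianInner_sub_left {f g h : E → ℝ}
    (hf : Integrable (fun v => f v * h v) (stdGaussian E))
    (hg : Integrable (fun v => g v * h v) (stdGaussian E)) :
    maxwellianInner (f - g) h = maxwellianInner f h - maxwellianInner g h := by
  simp only [maxwellianInner, Pi.sub_apply, sub_mul]
  exact integral_sub hf hg

omit [BorelSpace E] in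
/-- `⟪c • g, h⟫_M = c ⟪g, h⟫_M` (no integrability needed). [folklore] -/
theorem maxwellianInner_smul_left (c : ℝ) (g h : E → ℝ) :
    maxwellianInner (c • g) h = c * maxwellianInner g h := by
  rw [Pi.smul_def]
  exact maxwellianInner_const_mul_left c g h

/-- Completing the square: `‖f - c g‖²_M = ‖f‖²_M - 2c ⟪f, g⟫_M + c² ‖g‖²_M` for `f, g` of
temperate growth (all products are `M`-integrable). [folklore] -/
theorem maxwellianInner_sub_const_mul_self {f g : E → ℝ} (hf : f ∈ temperateGrowth E)
    (hg : g ∈ temperateGrowth E) (c : ℝ) :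
    maxwellianInner (fun v => f v - c * g v) (fun v => f v - c * g v) =
      maxwellianInner f f - 2 * c * maxwellianInner f g + c ^ 2 * maxwellianInner g g := by
  have hff := integrable_mul_stdGaussian hf hf
  have hfg := integrable_mul_stdGaussian hf hg
  have hgg := integrable_mul_stdGaussian hg hg
  simp only [maxwellianInner]
  have h : ∀ v, (f v - c * g v) * (f v - c * g v) =
      f v * f v - 2 * c * (f v * g v) + c ^ 2 * (g v * g v) := fun v => by ring
  simp_rw [h]
  have i1 : Integrable (fun v => f v * f v - 2 * c * (f v * g v)) (stdGaussian E) :=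
    hff.sub (hfg.const_mul _)
  have i2 : Integrable (fun v => c ^ 2 * (g v * g v)) (stdGaussian E) := hgg.const_mul _
  rw [integral_add i1 i2, integral_sub hff (hfg.const_mul _), integral_const_mul,
    integral_const_mul]

/-! ### The collision operator absorbs collision invariants -/

/-- Adding a collision invariant does not change the collision integrand, hence
`L_B (g + φ) = L_B g` *exactly*, junk values included (CIP 1994 §7.1, (1.6) and (1.11), p. 192).
[cite: CIP1994, §7.1 (1.6) and (1.11) p. 192] -/
theorem linearizedCollisionOp_add_of_isCollisionInvariant (B : E × E → sphere (0 : E) 1 → ℝ)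
    (g : E → ℝ) {φ : E → ℝ} (hφ : IsCollisionInvariant φ) :
    linearizedCollisionOp B (g + φ) = linearizedCollisionOp B g := by
  funext v
  simp only [linearizedCollisionOp, Pi.add_apply]
  congr 1
  funext w
  congr 1
  funext ω
  have h := hφ ω (v, w)
  dsimp only at h
  linear_combination (B (v, w) ω) * h

/-- `L (g + φ) = L g` for the linearised hard-sphere operator and a collision invariant `φ`
(CIP 1994 §7.1, (1.6) and (1.11), p. 192). [cite: CIP1994, §7.1 (1.6) and (1.11) p. 192] -/
theorem hardSphereLinearizedOp_add_of_isCollisionInvariant (g : E → ℝ) {φ : E → ℝ}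
    (hφ : IsCollisionInvariant φ) :
    hardSphereLinearizedOp (g + φ) = hardSphereLinearizedOp g :=
  linearizedCollisionOp_add_of_isCollisionInvariant _ g hφ

/-! ### Collision invariants: finite dimension and the `M`-orthogonal projection -/

omit [MeasurableSpace E] [BorelSpace E] in
/-- The collision invariants are spanned by the finitely many functions `1`, `|v|²` and
`v ↦ ⟪v, bᵢ⟫` for an orthonormal basis `(bᵢ)`; in particular they form a finite-dimensional
space (of dimension `d + 2`; CIP 1994 §3.1, Thm 3.1.1). [cite: CIP1994, §3.1 Thm 3.1.1] -/
theorem collisionInvariants_eq_span_finite :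
    collisionInvariants E =
      Submodule.span ℝ ({fun _ => (1 : ℝ), fun v => ‖v‖ ^ 2} ∪
        Set.range fun (i : Fin (finrank ℝ E)) (v : E) => ⟪v, stdOrthonormalBasis ℝ E i⟫_ℝ) := by
  set b := stdOrthonormalBasis ℝ E
  apply le_antisymm
  · refine Submodule.span_le.2 ?_
    rintro φ (hφ | ⟨e, rfl⟩)
    · exact Submodule.subset_span (Or.inl hφ)
    · have he : (fun v : E => ⟪v, e⟫_ℝ) = ∑ i, b.repr e i • fun v : E => ⟪v, b i⟫_ℝ := by
        funext v
        conv_lhs => rw [← b.sum_repr e]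
        simp only [inner_sum, Finset.sum_apply, Pi.smul_apply, smul_eq_mul, real_inner_smul_right]
      beta_reduce
      rw [he]
      exact Submodule.sum_mem _ fun i _ =>
        Submodule.smul_mem _ _ (Submodule.subset_span (Or.inr ⟨i, rfl⟩))
  · refine Submodule.span_mono ?_
    rintro φ (hφ | ⟨i, rfl⟩)
    · exact Or.inl hφ
    · exact Or.inr ⟨b i, rfl⟩

omit [MeasurableSpace E] [BorelSpace E] in
/-- The space of collision invariants is finite-dimensional (dimension `d + 2`; CIP 1994 §3.1,
Thm 3.1.1). [cite: CIP1994, §3.1 Thm 3.1.1] -/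
theorem finiteDimensional_collisionInvariants :
    FiniteDimensional ℝ (collisionInvariants E) := by
  rw [collisionInvariants_eq_span_finite]
  exact FiniteDimensional.span_of_finite ℝ ((Set.toFinite _).union (Set.finite_range _))

/-- **`M`-orthogonal projection onto the collision invariants.** Every function `g` of temperate
growth can be written `g = (g - p) + p` with `p` a collision invariant and `g - p`
`M`-orthogonal to all collision invariants: `⟪·, ·⟫_M` restricted to the finite-dimensional space
of collision invariants is positive definite (`maxwellianInner_self_pos`), hence non-degenerate,
so the functional `φ ↦ ⟪g, φ⟫_M` is represented by some `p` (`LinearMap.BilinForm.toDual`)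
(CIP 1994 §7.2, Thm 7.2.1: the null space of `L`; the decomposition `L² = N(L) ⊕ N(L)^⊥`).
[cite: CIP1994, §7.2 Thm 7.2.1 p. 197] -/
theorem exists_mem_collisionInvariants_forall_maxwellianInner_sub_eq_zero {g : E → ℝ}
    (hg : g ∈ temperateGrowth E) :
    ∃ p ∈ collisionInvariants E, ∀ φ ∈ collisionInvariants E, maxwellianInner (g - p) φ = 0 := by
  haveI := finiteDimensional_collisionInvariants (E := E)
  set W := collisionInvariants E
  have hT : ∀ q : W, (q : E → ℝ) ∈ temperateGrowth E := fun q =>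
    collisionInvariants_le_temperateGrowth q.2
  have hI : ∀ p q : W, Integrable (fun v => (p : E → ℝ) v * (q : E → ℝ) v) (stdGaussian E) :=
    fun p q => integrable_mul_stdGaussian (hT p) (hT q)
  -- the pairing as a bilinear form on `W`
  let β : LinearMap.BilinForm ℝ W :=
    LinearMap.mk₂ ℝ (fun p q : W => maxwellianInner (p : E → ℝ) (q : E → ℝ))
      (fun p₁ p₂ q => by
        simp only [Submodule.coe_add]
        exact maxwellianInner_add_left (hI p₁ q) (hI p₂ q))
      (fun c p q => by
        simp only [Submodule.coe_smul, smul_eq_mul]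
        exact maxwellianInner_smul_left c _ _)
      (fun p q₁ q₂ => by
        simp only [Submodule.coe_add]
        exact maxwellianInner_add_right (hI p q₁) (hI p q₂))
      (fun c p q => by
        simp only [Submodule.coe_smul, smul_eq_mul]
        rw [maxwellianInner_comm, maxwellianInner_smul_left, maxwellianInner_comm])
  have hβ : ∀ p q : W, β p q = maxwellianInner (p : E → ℝ) (q : E → ℝ) := fun p q => rfl
  -- positive definite, hence non-degenerate
  have hpos : ∀ p : W, β p p = 0 → p = 0 := fun p hp => by
    by_contra hne
    have hne' : (p : E → ℝ) ≠ 0 := fun h => hne (Subtype.ext h)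
    have := maxwellianInner_self_pos (hT p) hne'
    rw [hβ] at hp
    exact this.ne' hp
  have hnd : β.Nondegenerate :=
    ⟨fun p h => hpos p (h p), fun q h => hpos q (h q)⟩
  -- the functional `φ ↦ ⟪g, φ⟫_M` on `W`
  have hIg : ∀ q : W, Integrable (fun v => g v * (q : E → ℝ) v) (stdGaussian E) := fun q =>
    integrable_mul_stdGaussian hg (hT q)
  let ℓ : Module.Dual ℝ W :=
    { toFun := fun q => maxwellianInner g (q : E → ℝ)
      map_add' := fun q₁ q₂ => by
        simp only [Submodule.coe_add]
        exact maxwellianInner_add_right (hIg q₁) (hIg q₂)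
      map_smul' := fun c q => by
        simp only [Submodule.coe_smul, RingHom.id_apply, smul_eq_mul]
        rw [maxwellianInner_comm, maxwellianInner_smul_left, maxwellianInner_comm] }
  set p : W := (β.toDual hnd).symm ℓ with hp_def
  refine ⟨p, p.2, fun φ hφ => ?_⟩
  have hrep : maxwellianInner (p : E → ℝ) φ = maxwellianInner g φ := by
    have h := LinearMap.BilinForm.apply_toDual_symm_apply (hB := hnd) ℓ ⟨φ, hφ⟩
    rw [← hp_def, hβ] at h
    exact h
  rw [maxwellianInner_sub_left
    (integrable_mul_stdGaussian hg (collisionInvariants_le_temperateGrowth hφ)) (hI p ⟨φ, hφ⟩),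
    hrep, sub_self]

/-! ### The hard-sphere kernel satisfies the hypotheses of the symmetry fact -/

omit [FiniteDimensional ℝ E] in
/-- The hard-sphere kernel `((v - v_*)·ω)_+` is jointly measurable in `((v, v_*), ω)` (it is
continuous). [folklore] -/
theorem measurable_uncurry_hardSphereKernel [SecondCountableTopology E] :
    Measurable (Function.uncurry (hardSphereKernel (E := E))) := by
  have hc : Continuous (Function.uncurry (hardSphereKernel (E := E))) := by
    unfold hardSphereKernel Function.uncurry
    fun_prop
  exact hc.measurable

omit [FiniteDimensional ℝ E] [MeasurableSpace E] [BorelSpace E] in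
/-- The hard-sphere kernel is polynomially bounded: `|((v - v_*)·ω)_+| ≤ 2 (1 + ‖(v, v_*)‖)`.
[folklore] -/
theorem abs_hardSphereKernel_le :
    ∃ (k : ℕ) (C : ℝ), ∀ (p : E × E) (ω : sphere (0 : E) 1),
      |hardSphereKernel p ω| ≤ C * (1 + ‖p‖) ^ k := by
  refine ⟨1, 2, fun p ω => ?_⟩
  have hω : ‖(ω : E)‖ = 1 := norm_eq_of_mem_sphere ω
  have h1 : |hardSphereKernel p ω| ≤ |⟪p.1 - p.2, (ω : E)⟫_ℝ| := by
    unfold hardSphereKernel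
    rw [abs_of_nonneg (le_max_right _ _)]
    exact max_le (le_abs_self _) (abs_nonneg _)
  have h2 : |⟪p.1 - p.2, (ω : E)⟫_ℝ| ≤ ‖p.1 - p.2‖ := by
    simpa [hω] using abs_real_inner_le_norm (p.1 - p.2) (ω : E)
  have h3 : ‖p.1 - p.2‖ ≤ ‖p.1‖ + ‖p.2‖ := norm_sub_le _ _
  have h4 := norm_fst_le p
  have h5 := norm_snd_le p
  have h6 : 0 ≤ ‖p‖ := norm_nonneg p
  rw [pow_one]
  linarith

/-! ### Boundedness of the variational family from symmetry and the spectral gap -/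

/-- **Y from S and Z.** If the linearised collision operators are symmetric on functions of
temperate growth (named fact `maxwellianInner_linearizedCollisionOp_comm`) and the linearised
hard-sphere operator has a spectral gap `λ` on the `M`-orthogonal complement of the collision
invariants (named fact `le_neg_maxwellianInner_hardSphereLinearizedOp_of_orthogonal`), then for
`A` of temperate growth `M`-orthogonal to the collision invariants the variational family
`g ↦ 2⟪A, g⟫_M + ⟪g, L g⟫_M` is bounded above by `‖A‖²_M / λ` — the named fact
`bddAbove_range_dirichlet_of_orthogonal`. Proof: split `g = g₁ + p` (`p` the `M`-projection onto
the collision invariants); `L g = L g₁` exactly, `⟪g, L g₁⟫_M = ⟪L g, g₁⟫_M` by symmetry, so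
`⟪g, L g⟫_M = ⟪g₁, L g₁⟫_M ≤ -λ‖g₁‖²_M`, while `⟪A, g⟫_M = ⟪A, g₁⟫_M` and
`2⟪A, g₁⟫_M ≤ ‖A‖²_M/λ + λ‖g₁‖²_M` by completing the square
(CIP 1994 §7.2, Thm 7.2.1, p. 197 and Thm 7.2.5, p. 201).
[cite: CIP1994, §7.2 Thm 7.2.1 p. 197] -/
theorem bddAbove_range_dirichlet_of_orthogonal_of_comm_of_gap
    (hS : maxwellianInner_linearizedCollisionOp_comm (E := E))
    (hZ : le_neg_maxwellianInner_hardSphereLinearizedOp_of_orthogonal (E := E)) :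
    bddAbove_range_dirichlet_of_orthogonal (E := E) := by
  intro hE A hA horth
  obtain ⟨lam, hlam, hgap⟩ := hZ hE
  refine ⟨maxwellianInner A A / lam, ?_⟩
  rintro _ ⟨g, rfl⟩
  dsimp only
  -- split `g = g₁ + p`
  obtain ⟨p, hp, hperp⟩ :=
    exists_mem_collisionInvariants_forall_maxwellianInner_sub_eq_zero g.2
  have hpT : p ∈ temperateGrowth E := collisionInvariants_le_temperateGrowth hp
  set g₁ : E → ℝ := (g : E → ℝ) - p with hg₁_def
  have hg₁T : g₁ ∈ temperateGrowth E := sub_mem g.2 hpT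
  have hg_eq : (g : E → ℝ) = g₁ + p := (sub_add_cancel (g : E → ℝ) p).symm
  rw [hg_eq]
  -- (1) `L (g₁ + p) = L g₁`
  have hL : hardSphereLinearizedOp (g₁ + p) = hardSphereLinearizedOp g₁ :=
    hardSphereLinearizedOp_add_of_isCollisionInvariant g₁
      (isCollisionInvariant_of_mem_collisionInvariants hp)
  -- (2) `⟪g₁ + p, L g₁⟫ = ⟪L (g₁ + p), g₁⟫ = ⟪g₁, L g₁⟫`
  have hsymm : maxwellianInner (g₁ + p) (hardSphereLinearizedOp g₁) =
      maxwellianInner (hardSphereLinearizedOp (g₁ + p)) g₁ :=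
    hS measurable_uncurry_hardSphereKernel abs_hardSphereKernel_le
      Literature.Analysis.UnboundedOperators.hardSphereKernel_collide_neg
      Literature.Analysis.UnboundedOperators.hardSphereKernel_swap_neg hg₁T (add_mem hg₁T hpT)
  have h2 : maxwellianInner (g₁ + p) (hardSphereLinearizedOp (g₁ + p)) =
      maxwellianInner g₁ (hardSphereLinearizedOp g₁) := by
    rw [hL, hsymm, hL, maxwellianInner_comm]
  -- (3) `⟪A, g₁ + p⟫ = ⟪A, g₁⟫`
  have h3 : maxwellianInner A (g₁ + p) = maxwellianInner A g₁ := by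
    rw [maxwellianInner_add_right (integrable_mul_stdGaussian hA hg₁T)
      (integrable_mul_stdGaussian hA hpT), horth p hp, add_zero]
  -- (4) the gap for `g₁ ⊥ collision invariants`
  have h4 : lam * maxwellianInner g₁ g₁ ≤ -maxwellianInner g₁ (hardSphereLinearizedOp g₁) :=
    hgap g₁ hg₁T hperp
  -- (5) complete the square
  have h5 : 0 ≤ maxwellianInner A A - 2 * lam * maxwellianInner A g₁ +
      lam ^ 2 * maxwellianInner g₁ g₁ := by
    rw [← maxwellianInner_sub_const_mul_self hA hg₁T lam]
    exact maxwellianInner_self_nonneg _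
  rw [h2, h3]
  have key : 2 * maxwellianInner A g₁ ≤
      maxwellianInner A A / lam + lam * maxwellianInner g₁ g₁ := by
    rw [div_add' _ _ _ hlam.ne', le_div_iff₀ hlam]
    nlinarith [h5]
  linarith [key, h4]

/-- **The positivity fact from S and Z**: `⟪A, (-L)⁻¹ A⟫_M > 0` for every non-zero `A` of
temperate growth `M`-orthogonal to the collision invariants, assuming the symmetry fact
`maxwellianInner_linearizedCollisionOp_comm` and the spectral-gap fact
`le_neg_maxwellianInner_hardSphereLinearizedOp_of_orthogonal`
(CIP 1994 §7.2, Thm 7.2.1, p. 197; Baranger–Mouhot 2005, Thm 1.1).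
[cite: CIP1994, §7.2 Thm 7.2.1 p. 197] -/
theorem dirichletFormInv_pos_of_orthogonal_of_ne_zero_of_comm_of_gap
    (hS : maxwellianInner_linearizedCollisionOp_comm (E := E))
    (hZ : le_neg_maxwellianInner_hardSphereLinearizedOp_of_orthogonal (E := E)) :
    dirichletFormInv_pos_of_orthogonal_of_ne_zero (E := E) :=
  dirichletFormInv_pos_of_orthogonal_of_ne_zero_of_bddAbove
    (bddAbove_range_dirichlet_of_orthogonal_of_comm_of_gap hS hZ)

end

end Literature.Analysis.UnboundedOperators
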